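import Summits.Ventures.YMGap.Thresholds.OneLinkLevelTwoSDRows
import Summits.Ventures.YMGap.SlabAreaLaw
import Literature.MathematicalPhysics.QuantumFieldTheory.DurhuusFrohlichSlabCriterionProofs
import HarnessLib

/-!
# Venture YMGap — the one-link modulus beyond first order, part 25: Wilson AREA LAW rows of the variance-refined level-two
# modulus through the slab door — `HasAreaLaw d (fundamentalRep (Fin N)) (N·β)` for every `d ≥ 2`, every `N ≥ 4 / 6 / 10 / 20`

HONEST FRAMING: venture file of the cell `pub-ymgap` (QuantumFields programme), strong-coupling LATTICE statements for `SU(N)`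
lattice Yang–Mills on the `d`-dimensional torus (Wilson action, tree coupling `N·β`, 't Hooft `β`), volume-uniform finite-volume
area law `HasAreaLaw` (constructive-qft.S12); nothing about the continuum, the string tension's value, or the mass gap.  Kernel
ARITHMETIC over tree theorems, exactly as `OneLinkLevelTwoAreaLaw` (slab door `Slab.hasAreaLaw_of_oneLinkKRModulus` + the tree
theorem `durhuusFrohlich_areaLaw_of_slabClustering_holds`), with the variance-refined modulus `oneLinkKRModulus_levelTwoS`
(`K₂ˢ`, envelope `levelTwoSK_le`) in place of `K₂ʳ`:
* `hasAreaLaw_SU_levelTwoS_four (2 ≤ d) (4 ≤ N) (0 ≤ β) (2(d−1)β ≤ 33/125)`, `d = 4`: `β ≤ 11/250 = 0.044`;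
* `hasAreaLaw_SU_levelTwoS_six (6 ≤ N) (2(d−1)β ≤ 57/200)`, `d = 4`: `β ≤ 19/400 = 0.0475`;
* `hasAreaLaw_SU_levelTwoS_ten (10 ≤ N) (2(d−1)β ≤ 147/500)`, `d = 4`: `β ≤ 49/1000`;
* `hasAreaLaw_SU_levelTwoS_twenty (20 ≤ N) (2(d−1)β ≤ 3/10)`, `d = 4`: `β ≤ 1/20 = 0.05`;
each with its `d = 4` instance `…_d4`, and `areaLaw_numbers_levelTwoS`.  Printed Cao–Nissim–Sheffield (all `N`): `2(d−1)β < 1/4`,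
`d = 4`: `1/24 ≈ 0.0417`; previous file (`K₂ʳ`): `0.044 (N ≥ 6) | 0.0465 | 0.048 | 0.0485 (N ≥ 50)`.  Gain over the printed threshold in
every dimension: `+5.6 % (N ≥ 4) | +14 % | +17.6 % | +20 % (N ≥ 20)`.  CLASS: K (no hypothesis at all).
-/

noncomputable section

open scoped Matrix ComplexConjugate BigOperators ContDiff Matrix.Norms.Frobenius
open Matrix Complex Finset MeasureTheory ProbabilityTheory
open Literature.MathematicalPhysics.QuantumLattice
open Literature.MathematicalPhysics.QuantumFieldTheory
open Literature.MathematicalPhysics.QuantumFieldTheory.SUNBakryEmery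
open Literature.MathematicalPhysics.QuantumFieldTheory.Balaban1983to89.StrongCouplingDobrushinWindow
open Literature.MathematicalPhysics.QuantumFieldTheory.Balaban1983to89.StrongCouplingKernelWindow

namespace Summit.Ventures.YMGap.OneLinkEigen

variable {N : ℕ}

section LevelTwoSAreaLaw

open Summit.Ventures.YMGap.Slab (hasAreaLaw_of_oneLinkKRModulus)

/-- **`SU(N)` Wilson AREA LAW in every dimension `d ≥ 2`, for every `N ≥ 4` and every 't Hooft `0 ≤ β` with `2(d−1)β ≤ 33 / 125`**
(`d = 4`: `β ≤ 11 / 250 = 0.044`; printed Cao–Nissim–Sheffield `β < 1/(8(d−1))`) — hypothesis-free: the slab door with the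
variance-refined level-two one-link modulus on the ball `R = 2(d−1)β` (`R·K₂ˢ(N,R) ≤ (33 / 125)·K̄₂ˢ(4, 33 / 125) < 1` by `levelTwoSK_le`
and `norm_num`) and the tree theorem `durhuusFrohlich_areaLaw_of_slabClustering_holds`. [cite: CaoNissimSheffield2025dynamical, Theorems 1.6 and 2.3] -/
theorem hasAreaLaw_SU_levelTwoS_four {d : ℕ} (hd : 2 ≤ d) (hN : 4 ≤ N) {β : ℝ} (hβ : 0 ≤ β)
    (h : β * (2 * ((d : ℝ) - 1)) ≤ 33 / 125) : HasAreaLaw d (fundamentalRep (Fin N)) ((N : ℝ) * β) := by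
  have hd1 : (0 : ℝ) ≤ (d : ℝ) - 1 := by
    have : (2 : ℝ) ≤ d := by exact_mod_cast hd
    linarith
  obtain ⟨R, hRdef⟩ : ∃ R : ℝ, R = β * (2 * ((d : ℝ) - 1)) := ⟨_, rfl⟩
  have hR0 : 0 ≤ R := by rw [hRdef]; positivity
  have hRR₀ : R ≤ 33 / 125 := by rw [hRdef]; exact h
  have hR : R < 1 / 2 := by linarith
  have hN3 : 3 ≤ N := by omega
  have hK := levelTwoSK_le (N₀ := 4) (N := N) (by norm_num) hN (R := R) (R₀ := 33 / 125) (q := 707 / 2500)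
    hR0 hRR₀ (by norm_num) (by norm_num) (by norm_num)
  have hK0 : 0 ≤ ((N : ℝ) ^ 2 / ((N : ℝ) ^ 2 - 1)) *
        (1 + ((N : ℝ) ^ 2 / (2 * ((N : ℝ) ^ 2 - 4))) * R + 2 * (((N : ℝ) ^ 2 / (2 * ((N : ℝ) ^ 2 - 4))) + 1 / 4) * (R ^ 2 / 2 + R * Real.sqrt (R ^ 2 / 4 + 1 / (N : ℝ) ^ 2))
          + ((5 * ((N : ℝ) ^ 2 / (2 * ((N : ℝ) ^ 2 - 4))) + 1 / 4) * R ^ 2 + (10 * ((N : ℝ) ^ 2 / (2 * ((N : ℝ) ^ 2 - 4))) + 1 / 2) * R * (R ^ 2 / 2 + R * Real.sqrt (R ^ 2 / 4 + 1 / (N : ℝ) ^ 2))) / (1 / 2 - R)) := by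
    have h10 : (4 : ℝ) ≤ N := by exact_mod_cast hN
    have hN4 : (0 : ℝ) < (N : ℝ) ^ 2 - 4 := by nlinarith
    have hN1 : (0 : ℝ) < (N : ℝ) ^ 2 - 1 := by nlinarith
    have : 0 ≤ (N : ℝ) ^ 2 / ((N : ℝ) ^ 2 - 1) := div_nonneg (by positivity) hN1.le
    have : 0 ≤ (N : ℝ) ^ 2 / (2 * ((N : ℝ) ^ 2 - 4)) := div_nonneg (by positivity) (by positivity)
    have : 0 < 1 / 2 - R := by linarith
    positivity
  refine hasAreaLaw_of_oneLinkKRModulus durhuusFrohlich_areaLaw_of_slabClustering_holds hd (by omega) hβ hK0 hRdef.symm.le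
    (oneLinkKRModulus_levelTwoS hN3 hR) ?_
  have hnum : ((4 : ℝ) ^ 2 / ((4 : ℝ) ^ 2 - 1)) *
        (1 + ((4 : ℝ) ^ 2 / (2 * ((4 : ℝ) ^ 2 - 4))) * (33 / 125) + 2 * (((4 : ℝ) ^ 2 / (2 * ((4 : ℝ) ^ 2 - 4))) + 1 / 4) * ((33 / 125) ^ 2 / 2 + (33 / 125) * (707 / 2500))
          + ((5 * ((4 : ℝ) ^ 2 / (2 * ((4 : ℝ) ^ 2 - 4))) + 1 / 4) * (33 / 125) ^ 2 + (10 * ((4 : ℝ) ^ 2 / (2 * ((4 : ℝ) ^ 2 - 4))) + 1 / 2) * (33 / 125) * ((33 / 125) ^ 2 / 2 + (33 / 125) * (707 / 2500))) / (1 / 2 - (33 / 125))) * (33 / 125) < 1 := by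
    norm_num
  have e : 2 * ((d : ℝ) - 1) * β = R := by rw [hRdef]; ring
  rw [e]
  push_cast at hK
  nlinarith [mul_le_mul hK hRR₀ hR0 (by norm_num), hK0]

/-- `d = 4`: **`SU(N)` Wilson AREA LAW for every `N ≥ 4` at every 't Hooft `0 ≤ β ≤ 11 / 250`** (`0.044`; tree coupling `N·β`;
printed Cao–Nissim–Sheffield: `β < 1/24 ≈ 0.0417`), hypothesis-free. [cite: CaoNissimSheffield2025dynamical, Theorems 1.6 and 2.3] -/
theorem hasAreaLaw_SU_levelTwoS_four_d4 (hN : 4 ≤ N) {β : ℝ} (hβ : 0 ≤ β) (h : β ≤ 11 / 250) :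
    HasAreaLaw 4 (fundamentalRep (Fin N)) ((N : ℝ) * β) :=
  hasAreaLaw_SU_levelTwoS_four (d := 4) (by norm_num) hN hβ (by norm_num; linarith)

/-- **`SU(N)` Wilson AREA LAW in every dimension `d ≥ 2`, for every `N ≥ 6` and every 't Hooft `0 ≤ β` with `2(d−1)β ≤ 57 / 200`**
(`d = 4`: `β ≤ 19 / 400 = 0.0475`; printed Cao–Nissim–Sheffield `β < 1/(8(d−1))`) — hypothesis-free: the slab door with the
variance-refined level-two one-link modulus on the ball `R = 2(d−1)β` (`R·K₂ˢ(N,R) ≤ (57 / 200)·K̄₂ˢ(6, 57 / 200) < 1` by `levelTwoSK_le`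
and `norm_num`) and the tree theorem `durhuusFrohlich_areaLaw_of_slabClustering_holds`. [cite: CaoNissimSheffield2025dynamical, Theorems 1.6 and 2.3] -/
theorem hasAreaLaw_SU_levelTwoS_six {d : ℕ} (hd : 2 ≤ d) (hN : 6 ≤ N) {β : ℝ} (hβ : 0 ≤ β)
    (h : β * (2 * ((d : ℝ) - 1)) ≤ 57 / 200) : HasAreaLaw d (fundamentalRep (Fin N)) ((N : ℝ) * β) := by
  have hd1 : (0 : ℝ) ≤ (d : ℝ) - 1 := by
    have : (2 : ℝ) ≤ d := by exact_mod_cast hd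
    linarith
  obtain ⟨R, hRdef⟩ : ∃ R : ℝ, R = β * (2 * ((d : ℝ) - 1)) := ⟨_, rfl⟩
  have hR0 : 0 ≤ R := by rw [hRdef]; positivity
  have hRR₀ : R ≤ 57 / 200 := by rw [hRdef]; exact h
  have hR : R < 1 / 2 := by linarith
  have hN3 : 3 ≤ N := by omega
  have hK := levelTwoSK_le (N₀ := 6) (N := N) (by norm_num) hN (R := R) (R₀ := 57 / 200) (q := 2193 / 10000)
    hR0 hRR₀ (by norm_num) (by norm_num) (by norm_num)
  have hK0 : 0 ≤ ((N : ℝ) ^ 2 / ((N : ℝ) ^ 2 - 1)) *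
        (1 + ((N : ℝ) ^ 2 / (2 * ((N : ℝ) ^ 2 - 4))) * R + 2 * (((N : ℝ) ^ 2 / (2 * ((N : ℝ) ^ 2 - 4))) + 1 / 4) * (R ^ 2 / 2 + R * Real.sqrt (R ^ 2 / 4 + 1 / (N : ℝ) ^ 2))
          + ((5 * ((N : ℝ) ^ 2 / (2 * ((N : ℝ) ^ 2 - 4))) + 1 / 4) * R ^ 2 + (10 * ((N : ℝ) ^ 2 / (2 * ((N : ℝ) ^ 2 - 4))) + 1 / 2) * R * (R ^ 2 / 2 + R * Real.sqrt (R ^ 2 / 4 + 1 / (N : ℝ) ^ 2))) / (1 / 2 - R)) := by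
    have h10 : (6 : ℝ) ≤ N := by exact_mod_cast hN
    have hN4 : (0 : ℝ) < (N : ℝ) ^ 2 - 4 := by nlinarith
    have hN1 : (0 : ℝ) < (N : ℝ) ^ 2 - 1 := by nlinarith
    have : 0 ≤ (N : ℝ) ^ 2 / ((N : ℝ) ^ 2 - 1) := div_nonneg (by positivity) hN1.le
    have : 0 ≤ (N : ℝ) ^ 2 / (2 * ((N : ℝ) ^ 2 - 4)) := div_nonneg (by positivity) (by positivity)
    have : 0 < 1 / 2 - R := by linarith
    positivity
  refine hasAreaLaw_of_oneLinkKRModulus durhuusFrohlich_areaLaw_of_slabClustering_holds hd (by omega) hβ hK0 hRdef.symm.le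
    (oneLinkKRModulus_levelTwoS hN3 hR) ?_
  have hnum : ((6 : ℝ) ^ 2 / ((6 : ℝ) ^ 2 - 1)) *
        (1 + ((6 : ℝ) ^ 2 / (2 * ((6 : ℝ) ^ 2 - 4))) * (57 / 200) + 2 * (((6 : ℝ) ^ 2 / (2 * ((6 : ℝ) ^ 2 - 4))) + 1 / 4) * ((57 / 200) ^ 2 / 2 + (57 / 200) * (2193 / 10000))
          + ((5 * ((6 : ℝ) ^ 2 / (2 * ((6 : ℝ) ^ 2 - 4))) + 1 / 4) * (57 / 200) ^ 2 + (10 * ((6 : ℝ) ^ 2 / (2 * ((6 : ℝ) ^ 2 - 4))) + 1 / 2) * (57 / 200) * ((57 / 200) ^ 2 / 2 + (57 / 200) * (2193 / 10000))) / (1 / 2 - (57 / 200))) * (57 / 200) < 1 := by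
    norm_num
  have e : 2 * ((d : ℝ) - 1) * β = R := by rw [hRdef]; ring
  rw [e]
  push_cast at hK
  nlinarith [mul_le_mul hK hRR₀ hR0 (by norm_num), hK0]

/-- `d = 4`: **`SU(N)` Wilson AREA LAW for every `N ≥ 6` at every 't Hooft `0 ≤ β ≤ 19 / 400`** (`0.0475`; tree coupling `N·β`;
printed Cao–Nissim–Sheffield: `β < 1/24 ≈ 0.0417`), hypothesis-free. [cite: CaoNissimSheffield2025dynamical, Theorems 1.6 and 2.3] -/
theorem hasAreaLaw_SU_levelTwoS_six_d4 (hN : 6 ≤ N) {β : ℝ} (hβ : 0 ≤ β) (h : β ≤ 19 / 400) :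
    HasAreaLaw 4 (fundamentalRep (Fin N)) ((N : ℝ) * β) :=
  hasAreaLaw_SU_levelTwoS_six (d := 4) (by norm_num) hN hβ (by norm_num; linarith)

/-- **`SU(N)` Wilson AREA LAW in every dimension `d ≥ 2`, for every `N ≥ 10` and every 't Hooft `0 ≤ β` with `2(d−1)β ≤ 147 / 500`**
(`d = 4`: `β ≤ 49 / 1000 = 0.049`; printed Cao–Nissim–Sheffield `β < 1/(8(d−1))`) — hypothesis-free: the slab door with the
variance-refined level-two one-link modulus on the ball `R = 2(d−1)β` (`R·K₂ˢ(N,R) ≤ (147 / 500)·K̄₂ˢ(10, 147 / 500) < 1` by `levelTwoSK_le`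
and `norm_num`) and the tree theorem `durhuusFrohlich_areaLaw_of_slabClustering_holds`. [cite: CaoNissimSheffield2025dynamical, Theorems 1.6 and 2.3] -/
theorem hasAreaLaw_SU_levelTwoS_ten {d : ℕ} (hd : 2 ≤ d) (hN : 10 ≤ N) {β : ℝ} (hβ : 0 ≤ β)
    (h : β * (2 * ((d : ℝ) - 1)) ≤ 147 / 500) : HasAreaLaw d (fundamentalRep (Fin N)) ((N : ℝ) * β) := by
  have hd1 : (0 : ℝ) ≤ (d : ℝ) - 1 := by
    have : (2 : ℝ) ≤ d := by exact_mod_cast hd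
    linarith
  obtain ⟨R, hRdef⟩ : ∃ R : ℝ, R = β * (2 * ((d : ℝ) - 1)) := ⟨_, rfl⟩
  have hR0 : 0 ≤ R := by rw [hRdef]; positivity
  have hRR₀ : R ≤ 147 / 500 := by rw [hRdef]; exact h
  have hR : R < 1 / 2 := by linarith
  have hN3 : 3 ≤ N := by omega
  have hK := levelTwoSK_le (N₀ := 10) (N := N) (by norm_num) hN (R := R) (R₀ := 147 / 500) (q := 889 / 5000)
    hR0 hRR₀ (by norm_num) (by norm_num) (by norm_num)
  have hK0 : 0 ≤ ((N : ℝ) ^ 2 / ((N : ℝ) ^ 2 - 1)) *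
        (1 + ((N : ℝ) ^ 2 / (2 * ((N : ℝ) ^ 2 - 4))) * R + 2 * (((N : ℝ) ^ 2 / (2 * ((N : ℝ) ^ 2 - 4))) + 1 / 4) * (R ^ 2 / 2 + R * Real.sqrt (R ^ 2 / 4 + 1 / (N : ℝ) ^ 2))
          + ((5 * ((N : ℝ) ^ 2 / (2 * ((N : ℝ) ^ 2 - 4))) + 1 / 4) * R ^ 2 + (10 * ((N : ℝ) ^ 2 / (2 * ((N : ℝ) ^ 2 - 4))) + 1 / 2) * R * (R ^ 2 / 2 + R * Real.sqrt (R ^ 2 / 4 + 1 / (N : ℝ) ^ 2))) / (1 / 2 - R)) := by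
    have h10 : (10 : ℝ) ≤ N := by exact_mod_cast hN
    have hN4 : (0 : ℝ) < (N : ℝ) ^ 2 - 4 := by nlinarith
    have hN1 : (0 : ℝ) < (N : ℝ) ^ 2 - 1 := by nlinarith
    have : 0 ≤ (N : ℝ) ^ 2 / ((N : ℝ) ^ 2 - 1) := div_nonneg (by positivity) hN1.le
    have : 0 ≤ (N : ℝ) ^ 2 / (2 * ((N : ℝ) ^ 2 - 4)) := div_nonneg (by positivity) (by positivity)
    have : 0 < 1 / 2 - R := by linarith
    positivity
  refine hasAreaLaw_of_oneLinkKRModulus durhuusFrohlich_areaLaw_of_slabClustering_holds hd (by omega) hβ hK0 hRdef.symm.le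
    (oneLinkKRModulus_levelTwoS hN3 hR) ?_
  have hnum : ((10 : ℝ) ^ 2 / ((10 : ℝ) ^ 2 - 1)) *
        (1 + ((10 : ℝ) ^ 2 / (2 * ((10 : ℝ) ^ 2 - 4))) * (147 / 500) + 2 * (((10 : ℝ) ^ 2 / (2 * ((10 : ℝ) ^ 2 - 4))) + 1 / 4) * ((147 / 500) ^ 2 / 2 + (147 / 500) * (889 / 5000))
          + ((5 * ((10 : ℝ) ^ 2 / (2 * ((10 : ℝ) ^ 2 - 4))) + 1 / 4) * (147 / 500) ^ 2 + (10 * ((10 : ℝ) ^ 2 / (2 * ((10 : ℝ) ^ 2 - 4))) + 1 / 2) * (147 / 500) * ((147 / 500) ^ 2 / 2 + (147 / 500) * (889 / 5000))) / (1 / 2 - (147 / 500))) * (147 / 500) < 1 := by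
    norm_num
  have e : 2 * ((d : ℝ) - 1) * β = R := by rw [hRdef]; ring
  rw [e]
  push_cast at hK
  nlinarith [mul_le_mul hK hRR₀ hR0 (by norm_num), hK0]

/-- `d = 4`: **`SU(N)` Wilson AREA LAW for every `N ≥ 10` at every 't Hooft `0 ≤ β ≤ 49 / 1000`** (`0.049`; tree coupling `N·β`;
printed Cao–Nissim–Sheffield: `β < 1/24 ≈ 0.0417`), hypothesis-free. [cite: CaoNissimSheffield2025dynamical, Theorems 1.6 and 2.3] -/
theorem hasAreaLaw_SU_levelTwoS_ten_d4 (hN : 10 ≤ N) {β : ℝ} (hβ : 0 ≤ β) (h : β ≤ 49 / 1000) :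
    HasAreaLaw 4 (fundamentalRep (Fin N)) ((N : ℝ) * β) :=
  hasAreaLaw_SU_levelTwoS_ten (d := 4) (by norm_num) hN hβ (by norm_num; linarith)

/-- **`SU(N)` Wilson AREA LAW in every dimension `d ≥ 2`, for every `N ≥ 20` and every 't Hooft `0 ≤ β` with `2(d−1)β ≤ 3 / 10`**
(`d = 4`: `β ≤ 1 / 20 = 0.05`; printed Cao–Nissim–Sheffield `β < 1/(8(d−1))`) — hypothesis-free: the slab door with the
variance-refined level-two one-link modulus on the ball `R = 2(d−1)β` (`R·K₂ˢ(N,R) ≤ (3 / 10)·K̄₂ˢ(20, 3 / 10) < 1` by `levelTwoSK_le`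
and `norm_num`) and the tree theorem `durhuusFrohlich_areaLaw_of_slabClustering_holds`. [cite: CaoNissimSheffield2025dynamical, Theorems 1.6 and 2.3] -/
theorem hasAreaLaw_SU_levelTwoS_twenty {d : ℕ} (hd : 2 ≤ d) (hN : 20 ≤ N) {β : ℝ} (hβ : 0 ≤ β)
    (h : β * (2 * ((d : ℝ) - 1)) ≤ 3 / 10) : HasAreaLaw d (fundamentalRep (Fin N)) ((N : ℝ) * β) := by
  have hd1 : (0 : ℝ) ≤ (d : ℝ) - 1 := by
    have : (2 : ℝ) ≤ d := by exact_mod_cast hd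
    linarith
  obtain ⟨R, hRdef⟩ : ∃ R : ℝ, R = β * (2 * ((d : ℝ) - 1)) := ⟨_, rfl⟩
  have hR0 : 0 ≤ R := by rw [hRdef]; positivity
  have hRR₀ : R ≤ 3 / 10 := by rw [hRdef]; exact h
  have hR : R < 1 / 2 := by linarith
  have hN3 : 3 ≤ N := by omega
  have hK := levelTwoSK_le (N₀ := 20) (N := N) (by norm_num) hN (R := R) (R₀ := 3 / 10) (q := 791 / 5000)
    hR0 hRR₀ (by norm_num) (by norm_num) (by norm_num)
  have hK0 : 0 ≤ ((N : ℝ) ^ 2 / ((N : ℝ) ^ 2 - 1)) *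
        (1 + ((N : ℝ) ^ 2 / (2 * ((N : ℝ) ^ 2 - 4))) * R + 2 * (((N : ℝ) ^ 2 / (2 * ((N : ℝ) ^ 2 - 4))) + 1 / 4) * (R ^ 2 / 2 + R * Real.sqrt (R ^ 2 / 4 + 1 / (N : ℝ) ^ 2))
          + ((5 * ((N : ℝ) ^ 2 / (2 * ((N : ℝ) ^ 2 - 4))) + 1 / 4) * R ^ 2 + (10 * ((N : ℝ) ^ 2 / (2 * ((N : ℝ) ^ 2 - 4))) + 1 / 2) * R * (R ^ 2 / 2 + R * Real.sqrt (R ^ 2 / 4 + 1 / (N : ℝ) ^ 2))) / (1 / 2 - R)) := by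
    have h10 : (20 : ℝ) ≤ N := by exact_mod_cast hN
    have hN4 : (0 : ℝ) < (N : ℝ) ^ 2 - 4 := by nlinarith
    have hN1 : (0 : ℝ) < (N : ℝ) ^ 2 - 1 := by nlinarith
    have : 0 ≤ (N : ℝ) ^ 2 / ((N : ℝ) ^ 2 - 1) := div_nonneg (by positivity) hN1.le
    have : 0 ≤ (N : ℝ) ^ 2 / (2 * ((N : ℝ) ^ 2 - 4)) := div_nonneg (by positivity) (by positivity)
    have : 0 < 1 / 2 - R := by linarith
    positivity
  refine hasAreaLaw_of_oneLinkKRModulus durhuusFrohlich_areaLaw_of_slabClustering_holds hd (by omega) hβ hK0 hRdef.symm.le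
    (oneLinkKRModulus_levelTwoS hN3 hR) ?_
  have hnum : ((20 : ℝ) ^ 2 / ((20 : ℝ) ^ 2 - 1)) *
        (1 + ((20 : ℝ) ^ 2 / (2 * ((20 : ℝ) ^ 2 - 4))) * (3 / 10) + 2 * (((20 : ℝ) ^ 2 / (2 * ((20 : ℝ) ^ 2 - 4))) + 1 / 4) * ((3 / 10) ^ 2 / 2 + (3 / 10) * (791 / 5000))
          + ((5 * ((20 : ℝ) ^ 2 / (2 * ((20 : ℝ) ^ 2 - 4))) + 1 / 4) * (3 / 10) ^ 2 + (10 * ((20 : ℝ) ^ 2 / (2 * ((20 : ℝ) ^ 2 - 4))) + 1 / 2) * (3 / 10) * ((3 / 10) ^ 2 / 2 + (3 / 10) * (791 / 5000))) / (1 / 2 - (3 / 10))) * (3 / 10) < 1 := by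
    norm_num
  have e : 2 * ((d : ℝ) - 1) * β = R := by rw [hRdef]; ring
  rw [e]
  push_cast at hK
  nlinarith [mul_le_mul hK hRR₀ hR0 (by norm_num), hK0]

/-- `d = 4`: **`SU(N)` Wilson AREA LAW for every `N ≥ 20` at every 't Hooft `0 ≤ β ≤ 1 / 20`** (`0.05`; tree coupling `N·β`;
printed Cao–Nissim–Sheffield: `β < 1/24 ≈ 0.0417`), hypothesis-free. [cite: CaoNissimSheffield2025dynamical, Theorems 1.6 and 2.3] -/
theorem hasAreaLaw_SU_levelTwoS_twenty_d4 (hN : 20 ≤ N) {β : ℝ} (hβ : 0 ≤ β) (h : β ≤ 1 / 20) :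
    HasAreaLaw 4 (fundamentalRep (Fin N)) ((N : ℝ) * β) :=
  hasAreaLaw_SU_levelTwoS_twenty (d := 4) (by norm_num) hN hβ (by norm_num; linarith)

/-- The numbers: the `d = 4` area-law windows `1/24 < 11/250 < 19/400 < 49/1000 < 1/20` ('t Hooft), the slab radii
`1/4 < 33/125 < 57/200 < 147/500 < 3/10`, `6·β₀ = R₀` row by row, and the `K₂ʳ` rows of `OneLinkLevelTwoAreaLaw` they supersede
(`93/2000 < 49/1000`, `6/125 < 1/20`, `97/2000 < 1/20`). [folklore] -/
theorem areaLaw_numbers_levelTwoS :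
    (1 : ℝ) / 24 < 11 / 250 ∧ (11 : ℝ) / 250 < 19 / 400 ∧ (19 : ℝ) / 400 < 49 / 1000 ∧ (49 : ℝ) / 1000 < 1 / 20 ∧
      (1 : ℝ) / 4 < 33 / 125 ∧ (33 : ℝ) / 125 < 57 / 200 ∧ (57 : ℝ) / 200 < 147 / 500 ∧ (147 : ℝ) / 500 < 3 / 10 ∧
      (6 : ℝ) * (11 / 250) = 33 / 125 ∧ (6 : ℝ) * (19 / 400) = 57 / 200 ∧ (6 : ℝ) * (49 / 1000) = 147 / 500 ∧
      (6 : ℝ) * (1 / 20) = 3 / 10 ∧ (93 : ℝ) / 2000 < 49 / 1000 ∧ (6 : ℝ) / 125 < 1 / 20 ∧ (97 : ℝ) / 2000 < 1 / 20 := by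
  norm_num

end LevelTwoSAreaLaw

end Summit.Ventures.YMGap.OneLinkEigen
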